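import Summits.QuantumFields.YangMills.Theorems.BalabanUVNodesN15KingModelFreePropagatorOneDimension
import Summits.QuantumFields.YangMills.Theorems.BalabanUVNodesN15KingModelInfiniteVolumeSymmetries
import Summits.QuantumFields.YangMills.Theorems.BalabanUVNodesN15KingModelInfiniteVolumeClustering
import Summits.QuantumFields.YangMills.Theorems.BalabanUVNodesN15KingModelCovarianceOperatorBound
import Summits.QuantumFields.YangMills.Theorems.BalabanUVNodesN15KingModelSubGaussianTails
import Summits.QuantumFields.YangMills.Theorems.BalabanUVNodesN15KingModelMasslessFieldScaling
import Summits.QuantumFields.YangMills.Theorems.BalabanUVNodesN15KingModelMasslessClustering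
import Summits.QuantumFields.YangMills.Theorems.BalabanUVNodesN15KingModelBlockSpinSemigroup

/-!
# BalabanUVNodes ∕ N15 — THE KING-MODEL RUNG: PART Ϻ (san) PACKAGE TWO — the infinite-volume measure `μ_∞`, its reflection positivity, symmetries and clustering, the covariance-operator
# bound, sub-Gaussian tails, the mass-uniform bounds, the MASSLESS field `μ⁰_∞` (`d + 1 ≥ 3`) with two-sided canonical scaling, reflection positivity and mixing, and the EXACT BLOCK-SPIN
# RENORMALISATION GROUP `(R_L)_*μ_{∞,m²} = μ_{∞,L²m²}`, `(R_L)_*μ⁰_∞ = μ⁰_∞`, `(R_L)_*μ_{∞,m²} ≠ μ_{∞,m²}` — one conjunction, by name (Track A, DAG node N15 = NE2; count-neutral)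

HONEST FRAMING.  Count-neutral (cell `pub-ymgap`, seat `pub-ymgap-dag-n15-e` g36; `--supports stmt-QuantumFields-27366 --as helper` = K3⁸).  King's `A = 0`, `g = 0` model
([King1986] C. King, Commun. Math. Phys. **102** (1986) 649–677).  This file is an INDEX: the sixteen headline theorems of parts Ϻ-j … Ϻ-gg (files 326–348 of the seat's ledger) restated
verbatim and proved by name, so that a reader (or a successor seat) can cite ONE declaration for the infinite-volume ∕ massless ∕ renormalisation-group theory of King's free block field.
Nothing new is proved.  NOT Bałaban's objects; NOT a node discharge; nothing continuum-Yang–Mills ∕ `ℝ⁴` ∕ OS reconstruction ∕ Clay.  0 `sorry`, 0 def; standard axioms.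

WHAT THIS FILE PROVES (kernel).  ★★★ **`king_partSan_package₂`** — the conjunction of: (1) `freePropRadial_dim_one`; (2) `kingS2Inf_strictAnti_mass`; (3) `kingFieldInf_reflection_positive_exp`;
(4) `kingFieldInf_map_euclid`; (5) `tendsto_cov_exp_shift`; (6) `variance_fieldSum_le`; (7) `kingS2Inf_le_massless`; (8) `kingS2Inf_le_three`; (9) `ae_eventually_abs_eval_lt`;
(10) `tendsto_nPoint_mass_zero_kingFieldInf`; (11) `kingS2Inf0_two_sided`; (12) `kingFieldInf0_reflection_positive_exp`; (13) `tendsto_cov_exp_shift0`; (14) `kingS2Inf_rg_flow`;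
(15) `kingFieldInf_map_blockRG`; (16) `kingFieldInf0_map_blockRG`; (17) `kingFieldInf_map_blockRG_ne_self`.

HONEST SCOPE.  Index only.  N15 untouched; counts unmoved.  Locators (use): [King1986] Thm 2.1 (2.22)–(2.23) p.654, §2 (2.3)–(2.6) p.652, Thm 3.3 (3.6) p.655, (4.5)–(4.8) pp.670–671.
-/

noncomputable section

open scoped BigOperators Topology
open Filter MeasureTheory ProbabilityTheory Finset

namespace Summit.QuantumFields.YangMills.BalabanUVNodes.N15KingModelRung.InfiniteVolume

open Summit.QuantumFields.YangMills.BalabanUVNodes.N15KingModelRung.OptimalDecay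
open Summit.QuantumFields.YangMills.BalabanUVNodes.N15KingModelRung.ProperTime

/-- ★★★ **PART Ϻ (san), PACKAGE TWO** — the infinite-volume, massless and renormalisation-group theory of King's free continuum block field in one conjunction (seventeen headline theorems by name;
see the module docstring for the list). [cite: King1986, Thm 2.1 (2.22)–(2.23) p.654, §2 (2.3)–(2.6) p.652, Thm 3.3 (3.6) p.655] -/
theorem king_partSan_package₂ :
    -- (1) the one-dimensional propagator in closed form
    (∀ {m2 : ℝ}, 0 < m2 → ∀ R : ℝ, freePropRadial 0 m2 R = Real.exp (-(Real.sqrt m2 * |R|)) / (2 * Real.sqrt m2))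
    -- (2) the mass is a faithful, monotone parameter
    ∧ (∀ {d : ℕ} {m1 m2 : ℝ}, 0 < m1 → m1 < m2 → ∀ z : Fin (d + 1) → ℤ, kingS2Inf m2 z < kingS2Inf m1 z)
    -- (3) reflection positivity of the law μ_∞ on the exponential algebra
    ∧ (∀ {d : ℕ} (ν : Fin (d + 1)) {ι : Type} [Fintype ι] {m2 : ℝ}, 0 < m2 → ∀ (s : Finset (Fin (d + 1) → ℤ)), (∀ z ∈ s, 0 ≤ z ν) →
        ∀ (f : ι → (Fin (d + 1) → ℤ) → ℝ) (a : ι → ℝ),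
          0 ≤ ∫ ω, (∑ k, a k * Real.exp (∑ z ∈ s, f k z * ω (Function.update z ν (-(z ν) - 1)))) * (∑ l, a l * Real.exp (∑ z ∈ s, f l z * ω z)) ∂kingFieldInf m2)
    -- (4) lattice Euclidean invariance of μ_∞
    ∧ (∀ {d : ℕ} {m2 : ℝ}, 0 < m2 → ∀ (σ : Equiv.Perm (Fin (d + 1))) (μ : Fin (d + 1)) (v : Fin (d + 1) → ℤ),
        (kingFieldInf m2).map (fun (ω : (Fin (d + 1) → ℤ) → ℝ) (z : Fin (d + 1) → ℤ) => ω (latReflIdx μ (z ∘ σ) + v)) = kingFieldInf m2)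
    -- (5) mixing of μ_∞ on exponential observables
    ∧ (∀ {d : ℕ} {J J' : Type} {m2 : ℝ}, 0 < m2 → ∀ (T : Finset J) (p : J → Fin (d + 1) → ℤ) (c : J → ℝ) (T' : Finset J') (p' : J' → Fin (d + 1) → ℤ) (c' : J' → ℝ),
        Tendsto (fun v : Fin (d + 1) → ℤ => ∫ ω, Real.exp (∑ j ∈ T, c j * ω (p j)) * Real.exp (∑ k ∈ T', c' k * ω (p' k + v)) ∂kingFieldInf m2) cofinite
          (𝓝 ((∫ ω, Real.exp (∑ j ∈ T, c j * ω (p j)) ∂kingFieldInf m2) * (∫ ω, Real.exp (∑ k ∈ T', c' k * ω (p' k)) ∂kingFieldInf m2))))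
    -- (6) the covariance operator is bounded by m⁻²
    ∧ (∀ {d : ℕ} {m2 : ℝ}, 0 < m2 → ∀ {J : Type} (T : Finset J) {p : J → Fin (d + 1) → ℤ}, Function.Injective p → ∀ c : J → ℝ,
        Var[fun ω : (Fin (d + 1) → ℤ) → ℝ => ∑ j ∈ T, c j * ω (p j); kingFieldInf m2] ≤ m2⁻¹ * ∑ j ∈ T, c j ^ 2)
    -- (7) the mass-uniform power law (d + 1 ≥ 3)
    ∧ (∀ {d : ℕ} {m2 : ℝ}, 2 ≤ d → 0 < m2 → ∀ {z : Fin (d + 1) → ℤ}, 0 < blockGap z →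
        kingS2Inf m2 z ≤ Real.Gamma (((d : ℝ) - 1) / 2) / (4 * Real.pi ^ (((d : ℝ) + 1) / 2) * blockGap z ^ (d - 1)))
    -- (8) the mass-uniform global bound
    ∧ (∀ {d : ℕ} {m2 : ℝ}, 2 ≤ d → 0 < m2 → ∀ z : Fin (d + 1) → ℤ, kingS2Inf m2 z ≤ 3)
    -- (9) almost-sure logarithmic growth
    ∧ (∀ {d : ℕ} {m2 : ℝ}, 0 < m2 →
        ∀ᵐ ω ∂kingFieldInf m2, ∀ᶠ z : Fin (d + 1) → ℤ in cofinite, |ω z| < 2 * Real.sqrt (kingS2Inf m2 (0 : Fin (d + 1) → ℤ) * ∑ ν, Real.log (2 + |(z ν : ℝ)|)))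
    -- (10) the massless field as the limit of all moments
    ∧ (∀ {d : ℕ}, 2 ≤ d → ∀ {W : Type} [DecidableEq W] [LinearOrder W] (z : W → Fin (d + 1) → ℤ) (S : Finset W),
        Tendsto (fun m2 : ℝ => ∫ ω, (∏ i ∈ S, ω (z i)) ∂kingFieldInf m2) (𝓝[>] 0) (𝓝 (∫ ω, (∏ i ∈ S, ω (z i)) ∂kingFieldInf0 d)))
    -- (11) two-sided canonical scaling of the massless two-point function
    ∧ (∀ {d : ℕ}, 2 ≤ d → ∀ {z : Fin (d + 1) → ℤ}, 0 < blockGap z →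
        Real.Gamma (((d : ℝ) - 1) / 2) / (4 * Real.pi ^ (((d : ℝ) + 1) / 2) * blockSpan z ^ (d - 1)) ≤ kingS2Inf0 z
          ∧ kingS2Inf0 z ≤ Real.Gamma (((d : ℝ) - 1) / 2) / (4 * Real.pi ^ (((d : ℝ) + 1) / 2) * blockGap z ^ (d - 1)))
    -- (12) reflection positivity of the massless law
    ∧ (∀ {d : ℕ} (ν : Fin (d + 1)) {ι : Type} [Fintype ι], 2 ≤ d → ∀ (s : Finset (Fin (d + 1) → ℤ)), (∀ z ∈ s, 0 ≤ z ν) →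
        ∀ (f : ι → (Fin (d + 1) → ℤ) → ℝ) (a : ι → ℝ),
          0 ≤ ∫ ω, (∑ k, a k * Real.exp (∑ z ∈ s, f k z * ω (Function.update z ν (-(z ν) - 1)))) * (∑ l, a l * Real.exp (∑ z ∈ s, f l z * ω z)) ∂kingFieldInf0 d)
    -- (13) mixing of the massless law
    ∧ (∀ {d : ℕ} {J J' : Type}, 2 ≤ d → ∀ (T : Finset J) (p : J → Fin (d + 1) → ℤ) (c : J → ℝ) (T' : Finset J') (p' : J' → Fin (d + 1) → ℤ) (c' : J' → ℝ),
        Tendsto (fun v : Fin (d + 1) → ℤ => ∫ ω, Real.exp (∑ j ∈ T, c j * ω (p j)) * Real.exp (∑ k ∈ T', c' k * ω (p' k + v)) ∂kingFieldInf0 d) cofinite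
          (𝓝 ((∫ ω, Real.exp (∑ j ∈ T, c j * ω (p j)) ∂kingFieldInf0 d) * (∫ ω, Real.exp (∑ k ∈ T', c' k * ω (p' k)) ∂kingFieldInf0 d))))
    -- (14) the exact RG flow of the two-point function
    ∧ (∀ {d : ℕ} {m2 : ℝ}, 0 < m2 → ∀ {L : ℕ}, 1 ≤ L → ∀ z : Fin (d + 1) → ℤ,
        ∑ a : Fin (d + 1) → Fin L, ∑ b : Fin (d + 1) → Fin L, kingS2Inf m2 (fun μ => (L : ℤ) * z μ + ((a μ : ℕ) : ℤ) - ((b μ : ℕ) : ℤ))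
          = (L : ℝ) ^ (d + 3) * kingS2Inf ((L : ℝ) ^ 2 * m2) z)
    -- (15) the block-spin RG acts on the laws by m ↦ Lm
    ∧ (∀ {d : ℕ} {m2 : ℝ}, 0 < m2 → ∀ {L : ℕ}, 1 ≤ L → (kingFieldInf (d := d) m2).map (blockRG d L) = kingFieldInf ((L : ℝ) ^ 2 * m2))
    -- (16) the massless law is a fixed point
    ∧ (∀ {d : ℕ}, 2 ≤ d → ∀ {L : ℕ}, 1 ≤ L → (kingFieldInf0 d).map (blockRG d L) = kingFieldInf0 d)
    -- (17) and no massive law is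
    ∧ (∀ {d : ℕ} {m2 : ℝ}, 0 < m2 → ∀ {L : ℕ}, 2 ≤ L → (kingFieldInf (d := d) m2).map (blockRG d L) ≠ kingFieldInf m2) :=
  ⟨fun hm R => freePropRadial_dim_one hm R,
   fun h1 h12 z => kingS2Inf_strictAnti_mass h1 h12 z,
   fun ν _ _ _ hm s hs f a => kingFieldInf_reflection_positive_exp ν hm s hs f a,
   fun hm σ μ v => kingFieldInf_map_euclid hm σ μ v,
   fun hm T p c T' p' c' => tendsto_cov_exp_shift hm T p c T' p' c',
   fun hm _ T _ hp c => variance_fieldSum_le hm T hp c,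
   fun hd hm _ hgap => kingS2Inf_le_massless hd hm hgap,
   fun hd hm z => kingS2Inf_le_three hd hm z,
   fun hm => ae_eventually_abs_eval_lt hm,
   fun hd _ _ _ z S => tendsto_nPoint_mass_zero_kingFieldInf hd z S,
   fun hd _ hgap => kingS2Inf0_two_sided hd hgap,
   fun ν _ _ hd s hs f a => kingFieldInf0_reflection_positive_exp ν hd s hs f a,
   fun hd T p c T' p' c' => tendsto_cov_exp_shift0 hd T p c T' p' c',
   fun hm _ hL z => kingS2Inf_rg_flow hm hL z,
   fun hm _ hL => kingFieldInf_map_blockRG hm hL,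
   fun hd _ hL => kingFieldInf0_map_blockRG hd hL,
   fun hm _ hL => kingFieldInf_map_blockRG_ne_self hm hL⟩

end Summit.QuantumFields.YangMills.BalabanUVNodes.N15KingModelRung.InfiniteVolume
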